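import Summits.QuantumFields.GaugeBoot.ZdGaugeInvariantLineAverages
import Summits.QuantumFields.GaugeBoot.GaugeInvariantBootstrap
import HarnessLib

/-!
# `ℤ^d`: Wilson loops generate the gauge-invariant polynomial local observables (gauge-boot, FFT/ℤ^d 4/4)

HONEST FRAMING (cell `pub-gaugeboot`, page 1 of every file): the venture produces certified bounds
on lattice expectations at stated coupling, gauge group, dimension and torus size; NOT a mass gap,
NOT a continuum limit, NOT a string tension; NOT Yang–Mills-summit-bearing (barriers
`FixedCouplingUltralocality`, `PerturbativeInvisibility`). Structural statement about the LOCAL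
observable algebra of lattice gauge theory on `ℤ^d` (the setting of the lane's DLR / infinite-volume
bootstrap statements); no number is certified.

## Content (`ℤ^d`, compact `G`, `r : LatticeRep G` with `SU(N) ⊆ ρ(G) ⊆ U(N)`, `N ≥ 1`)

* `cmRe`, `cmIm`, `cmOfReal` — real/imaginary part and complexification of continuous observables
  on any space; `loopReZd r x w`, `loopImZd r x w` — real Wilson loops `Re/Im tr ρ(hol_x w)` on `ℤ^d`;
  `loopAlgebraZd r x` — the real multi-trace Wilson loop algebra of local observables at `x`.
* ★★★ `isZdGaugeInvariant_iff_mem_loopAlgebraZd` (+ `_suN`, `_uN`),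
  `mem_loopAlgebraZd_of_isZdGaugeInvariant` — FIRST FUNDAMENTAL THEOREM on `ℤ^d`: a polynomial local
  observable (the tree's `polyAlgebra (ι := ZdEdge d) r`) is invariant under all gauge
  transformations of `ℤ^d` iff it is a polynomial in Wilson loops through the origin.
* ★★ `gaugeAvgZdL_mem_loopAlgebraZd` — the `ℤ^d` gauge average of every polynomial local observable
  is a Wilson-loop polynomial (so the lane's `ℤ^d` bootstrap / DLR statements on "gauge-invariant
  polynomial data" are statements about Wilson loops).

References: B. Durhuus, Lett. Math. Phys. 4 (1980) 515–522; A. Sengupta, Proc. AMS 121 (1994).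
-/

noncomputable section

namespace Summit.QuantumFields.GaugeBoot

open MeasureTheory Matrix Finset TensorFFT
open scoped ComplexConjugate
open Literature.MathematicalPhysics.QuantumFieldTheory (LatticeRep haarProbability)
open Literature.MathematicalPhysics.QuantumLattice

/-! ## Real and complex continuous observables (any space) -/

section ReIm

variable {α : Type*} [TopologicalSpace α]

/-- Complexification of a real continuous observable. [folklore] -/
def cmOfReal : C(α, ℝ) →ₐ[ℝ] C(α, ℂ) := Complex.ofRealAm.compLeftContinuous ℝ Complex.continuous_ofReal

/-- Real part of a complex continuous observable. [folklore] -/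
def cmRe (F : C(α, ℂ)) : C(α, ℝ) := ⟨fun x => (F x).re, Complex.continuous_re.comp F.continuous⟩

/-- Imaginary part of a complex continuous observable. [folklore] -/
def cmIm (F : C(α, ℂ)) : C(α, ℝ) := ⟨fun x => (F x).im, Complex.continuous_im.comp F.continuous⟩

/-- `cmOfReal` evaluated. -/
@[simp] theorem cmOfReal_apply (f : C(α, ℝ)) (x : α) : cmOfReal f x = (f x : ℂ) := rfl

/-- `cmRe` evaluated. -/
@[simp] theorem cmRe_apply (F : C(α, ℂ)) (x : α) : cmRe F x = (F x).re := rfl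

/-- `cmIm` evaluated. -/
@[simp] theorem cmIm_apply (F : C(α, ℂ)) (x : α) : cmIm F x = (F x).im := rfl

/-- `cmRe (cmOfReal f) = f`. -/
theorem cmRe_cmOfReal (f : C(α, ℝ)) : cmRe (cmOfReal f) = f := by ext x; simp

/-- Real parts of the elements of a `ℂ`-algebra generated by observables whose real and imaginary
parts lie in an `ℝ`-subalgebra `A` lie in `A` (and so do the imaginary parts). -/
theorem cmRe_mem_of_mem_adjoin {S : Set C(α, ℂ)} {A : Subalgebra ℝ C(α, ℝ)}
    (hS : ∀ F ∈ S, cmRe F ∈ A ∧ cmIm F ∈ A) {F : C(α, ℂ)} (hF : F ∈ Algebra.adjoin ℂ S) :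
    cmRe F ∈ A ∧ cmIm F ∈ A := by
  induction hF using Algebra.adjoin_induction with
  | mem F hF => exact hS F hF
  | algebraMap c =>
    refine ⟨?_, ?_⟩
    · rw [show cmRe (algebraMap ℂ C(α, ℂ) c) = algebraMap ℝ C(α, ℝ) c.re from rfl]
      exact Subalgebra.algebraMap_mem _ _
    · rw [show cmIm (algebraMap ℂ C(α, ℂ) c) = algebraMap ℝ C(α, ℝ) c.im from rfl]
      exact Subalgebra.algebraMap_mem _ _
  | add F H _ _ ihF ihH =>
    refine ⟨?_, ?_⟩
    · rw [show cmRe (F + H) = cmRe F + cmRe H from by ext x; simp]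
      exact Subalgebra.add_mem _ ihF.1 ihH.1
    · rw [show cmIm (F + H) = cmIm F + cmIm H from by ext x; simp]
      exact Subalgebra.add_mem _ ihF.2 ihH.2
  | mul F H _ _ ihF ihH =>
    refine ⟨?_, ?_⟩
    · rw [show cmRe (F * H) = cmRe F * cmRe H - cmIm F * cmIm H from by ext x; simp [Complex.mul_re]]
      exact Subalgebra.sub_mem _ (Subalgebra.mul_mem _ ihF.1 ihH.1) (Subalgebra.mul_mem _ ihF.2 ihH.2)
    · rw [show cmIm (F * H) = cmRe F * cmIm H + cmIm F * cmRe H from by ext x; simp [Complex.mul_im]]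
      exact Subalgebra.add_mem _ (Subalgebra.mul_mem _ ihF.1 ihH.2) (Subalgebra.mul_mem _ ihF.2 ihH.1)

end ReIm

/-! ## The real Wilson loop algebra on `ℤ^d` -/

section Zd

open Literature.Probability.LatticeModels (Site)

variable {d : ℕ} {G : Type*} [Group G] [TopologicalSpace G] [IsTopologicalGroup G] (r : LatticeRep G)

/-- **Wilson loop on `ℤ^d`, real part** `U ↦ Re tr ρ(hol_x(w) U)`. [folklore] -/
def loopReZd (x : Site d) (w : Word d) : C(LGConfig d G, ℝ) := cmRe (loopCZd r x w)

/-- **Wilson loop on `ℤ^d`, imaginary part** `U ↦ Im tr ρ(hol_x(w) U)`. [folklore] -/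
def loopImZd (x : Site d) (w : Word d) : C(LGConfig d G, ℝ) := cmIm (loopCZd r x w)

/-- `loopReZd` evaluated. -/
@[simp] theorem loopReZd_apply (x : Site d) (w : Word d) (U : LGConfig d G) :
    loopReZd r x w U = (r.ρ (wordHolonomyZd U x w)).trace.re := rfl

/-- `loopImZd` evaluated. -/
@[simp] theorem loopImZd_apply (x : Site d) (w : Word d) (U : LGConfig d G) :
    loopImZd r x w U = (r.ρ (wordHolonomyZd U x w)).trace.im := rfl

/-- **The real multi-trace Wilson loop algebra of local observables at `x ∈ ℤ^d`.** [folklore] -/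
def loopAlgebraZd (x : Site d) : Subalgebra ℝ C(LGConfig d G, ℝ) :=
  Algebra.adjoin ℝ {f | ∃ w : Word d, Word.endpointZd x w = x ∧ (f = loopReZd r x w ∨ f = loopImZd r x w)}

/-- Entries of closed-word holonomies are polynomial: `lineCZd`'s real and imaginary parts lie in
`polyAlgebra`, by induction on the word. -/
theorem cmRe_lineCZd_mem (x : Site d) :
    ∀ (w : Word d) (a b : Fin r.N), cmRe (lineCZd r x w a b) ∈ polyAlgebra (ι := ZdEdge d) r ∧
      cmIm (lineCZd r x w a b) ∈ polyAlgebra (ι := ZdEdge d) r := by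
  intro w
  induction w generalizing x with
  | nil =>
    intro a b
    refine ⟨?_, ?_⟩
    · rw [show cmRe (lineCZd r x [] a b) = algebraMap ℝ C(LGConfig d G, ℝ) (if a = b then 1 else 0) from by
        ext U; by_cases h : a = b <;> simp [h]]
      exact Subalgebra.algebraMap_mem _ _
    · rw [show cmIm (lineCZd r x [] a b) = 0 from by ext U; by_cases h : a = b <;> simp [h]]
      exact Subalgebra.zero_mem _
  | cons s w ih =>
    intro a b
    -- `ρ(step · hol)_{ab} = Σ_c ρ(step)_{ac} ρ(hol)_{cb}`
    have hstep : ∀ c, cmRe (⟨fun U => r.ρ (stepHolonomyZd U x s) a c,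
        (r.continuous.comp (continuous_stepHolonomyZd x s)).matrix_elem a c⟩ : C(LGConfig d G, ℂ)) ∈
          polyAlgebra (ι := ZdEdge d) r ∧
        cmIm (⟨fun U => r.ρ (stepHolonomyZd U x s) a c,
          (r.continuous.comp (continuous_stepHolonomyZd x s)).matrix_elem a c⟩ : C(LGConfig d G, ℂ)) ∈
          polyAlgebra (ι := ZdEdge d) r := by
      intro c
      cases s with
      | fwd μ => exact ⟨reEntry_mem r (x, μ) a c, imEntry_mem r (x, μ) a c⟩
      | bwd μ =>
        refine ⟨?_, ?_⟩
        · rw [show cmRe (⟨fun U => r.ρ (stepHolonomyZd U x (Step.bwd μ)) a c, _⟩ : C(LGConfig d G, ℂ)) =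
              reEntry r (x - Pi.single μ 1, μ) c a from by
            ext U; simp [stepHolonomyZd, rho_inv_apply, Complex.conj_re]]
          exact reEntry_mem r _ c a
        · rw [show cmIm (⟨fun U => r.ρ (stepHolonomyZd U x (Step.bwd μ)) a c, _⟩ : C(LGConfig d G, ℂ)) =
              -imEntry r (x - Pi.single μ 1, μ) c a from by
            ext U; simp [stepHolonomyZd, rho_inv_apply, Complex.conj_im]]
          exact Subalgebra.neg_mem _ (imEntry_mem r _ c a)
    have e1 : cmRe (lineCZd r x (s :: w) a b) = ∑ c,
        (cmRe (⟨fun U => r.ρ (stepHolonomyZd U x s) a c,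
          (r.continuous.comp (continuous_stepHolonomyZd x s)).matrix_elem a c⟩ : C(LGConfig d G, ℂ)) *
          cmRe (lineCZd r (s.applyZd x) w c b) -
        cmIm (⟨fun U => r.ρ (stepHolonomyZd U x s) a c,
          (r.continuous.comp (continuous_stepHolonomyZd x s)).matrix_elem a c⟩ : C(LGConfig d G, ℂ)) *
          cmIm (lineCZd r (s.applyZd x) w c b)) := by
      ext U
      simp [Matrix.mul_apply, Complex.re_sum, Complex.mul_re, ContinuousMap.sum_apply]
    have e2 : cmIm (lineCZd r x (s :: w) a b) = ∑ c,
        (cmRe (⟨fun U => r.ρ (stepHolonomyZd U x s) a c,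
          (r.continuous.comp (continuous_stepHolonomyZd x s)).matrix_elem a c⟩ : C(LGConfig d G, ℂ)) *
          cmIm (lineCZd r (s.applyZd x) w c b) +
        cmIm (⟨fun U => r.ρ (stepHolonomyZd U x s) a c,
          (r.continuous.comp (continuous_stepHolonomyZd x s)).matrix_elem a c⟩ : C(LGConfig d G, ℂ)) *
          cmRe (lineCZd r (s.applyZd x) w c b)) := by
      ext U
      simp [Matrix.mul_apply, Complex.im_sum, Complex.mul_im, ContinuousMap.sum_apply]
    refine ⟨?_, ?_⟩
    · rw [e1]
      exact Subalgebra.sum_mem _ fun c _ => Subalgebra.sub_mem _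
        (Subalgebra.mul_mem _ (hstep c).1 (ih (s.applyZd x) c b).1)
        (Subalgebra.mul_mem _ (hstep c).2 (ih (s.applyZd x) c b).2)
    · rw [e2]
      exact Subalgebra.sum_mem _ fun c _ => Subalgebra.add_mem _
        (Subalgebra.mul_mem _ (hstep c).1 (ih (s.applyZd x) c b).2)
        (Subalgebra.mul_mem _ (hstep c).2 (ih (s.applyZd x) c b).1)

/-- Wilson loops on `ℤ^d` are polynomial observables. -/
theorem loopReZd_mem_polyAlgebra (x : Site d) (w : Word d) :
    loopReZd r x w ∈ polyAlgebra (ι := ZdEdge d) r ∧ loopImZd r x w ∈ polyAlgebra (ι := ZdEdge d) r := by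
  have e1 : loopReZd r x w = ∑ a, cmRe (lineCZd r x w a a) := by
    ext U; simp [Matrix.trace, Complex.re_sum, ContinuousMap.sum_apply]
  have e2 : loopImZd r x w = ∑ a, cmIm (lineCZd r x w a a) := by
    ext U; simp [Matrix.trace, Complex.im_sum, ContinuousMap.sum_apply]
  exact ⟨e1 ▸ Subalgebra.sum_mem _ fun a _ => (cmRe_lineCZd_mem r x w a a).1,
    e2 ▸ Subalgebra.sum_mem _ fun a _ => (cmRe_lineCZd_mem r x w a a).2⟩

/-- Wilson loops of closed words on `ℤ^d` are gauge invariant. -/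
theorem isZdGaugeInvariant_loopReZd (x : Site d) {w : Word d} (hw : Word.endpointZd x w = x) :
    IsZdGaugeInvariant (⇑(loopReZd r x w)) ∧ IsZdGaugeInvariant (⇑(loopImZd r x w)) := by
  have h : ∀ (γ : Site d → G) (U : LGConfig d G),
      (r.ρ (wordHolonomyZd (gaugeTransformZd γ U) x w)).trace = (r.ρ (wordHolonomyZd U x w)).trace := by
    intro γ U
    rw [wordHolonomyZd_gaugeTransformZd, hw, map_mul, map_mul, Matrix.trace_mul_cycle, ← map_mul,
      inv_mul_cancel, map_one, Matrix.one_mul]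
  exact ⟨fun γ U => by rw [loopReZd_apply, loopReZd_apply, h], fun γ U => by rw [loopImZd_apply, loopImZd_apply, h]⟩

/-- ★ **The `ℤ^d` loop algebra consists of gauge-invariant polynomial observables** (easy half). -/
theorem loopAlgebraZd_le (x : Site d) {f : C(LGConfig d G, ℝ)} (hf : f ∈ loopAlgebraZd (d := d) r x) :
    f ∈ polyAlgebra (ι := ZdEdge d) r ∧ IsZdGaugeInvariant (⇑f) := by
  induction hf using Algebra.adjoin_induction with
  | mem f hf =>
    obtain ⟨w, hw, rfl | rfl⟩ := hf
    · exact ⟨(loopReZd_mem_polyAlgebra r x w).1, (isZdGaugeInvariant_loopReZd r x hw).1⟩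
    · exact ⟨(loopReZd_mem_polyAlgebra r x w).2, (isZdGaugeInvariant_loopReZd r x hw).2⟩
  | algebraMap c => exact ⟨Subalgebra.algebraMap_mem _ c, fun γ U => rfl⟩
  | add f g _ _ ihf ihg =>
    exact ⟨Subalgebra.add_mem _ ihf.1 ihg.1, fun γ U => by
      simp only [ContinuousMap.add_apply, ihf.2 γ U, ihg.2 γ U]⟩
  | mul f g _ _ ihf ihg =>
    exact ⟨Subalgebra.mul_mem _ ihf.1 ihg.1, fun γ U => by
      simp only [ContinuousMap.mul_apply, ihf.2 γ U, ihg.2 γ U]⟩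

omit [IsTopologicalGroup G] in
/-- ★ **Real polynomial observables on `ℤ^d` complexify into complex polynomial observables.** -/
theorem cmOfReal_mem_polyAlgebraCZd {f : C(LGConfig d G, ℝ)} (hf : f ∈ polyAlgebra (ι := ZdEdge d) r) :
    cmOfReal f ∈ polyAlgebraCZd (d := d) r := by
  change f ∈ Subalgebra.comap cmOfReal ((polyAlgebraCZd (d := d) r).restrictScalars ℝ)
  refine (Algebra.adjoin_le ?_ : polyAlgebra (ι := ZdEdge d) r ≤ _) hf
  have hE : ∀ (e : ZdEdge d) (a b : Fin r.N), entryCZd r e a b ∈ polyAlgebraCZd (d := d) r :=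
    fun e a b => Algebra.subset_adjoin (Or.inl ⟨e, a, b, rfl⟩)
  have hS : ∀ (e : ZdEdge d) (a b : Fin r.N), star (entryCZd r e a b) ∈ polyAlgebraCZd (d := d) r :=
    fun e a b => Algebra.subset_adjoin (Or.inr ⟨e, a, b, rfl⟩)
  rintro g (⟨⟨e, a, b⟩, rfl⟩ | ⟨⟨e, a, b⟩, rfl⟩)
  · have e1 : cmOfReal (reEntry r e a b) =
        ((2 : ℂ)⁻¹ • (entryCZd r e a b + star (entryCZd r e a b)) : C(LGConfig d G, ℂ)) := by
      ext U
      simp only [cmOfReal_apply, reEntry_apply, ContinuousMap.smul_apply, ContinuousMap.add_apply,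
        ContinuousMap.star_apply, entryCZd_apply, smul_eq_mul, Complex.re_eq_add_conj, Complex.star_def]
      ring
    rw [SetLike.mem_coe, Subalgebra.mem_comap, Subalgebra.mem_restrictScalars, e1]
    exact Subalgebra.smul_mem _ (Subalgebra.add_mem _ (hE e a b) (hS e a b)) _
  · have e1 : cmOfReal (imEntry r e a b) =
        ((-(Complex.I / 2)) • (entryCZd r e a b - star (entryCZd r e a b)) : C(LGConfig d G, ℂ)) := by
      ext U
      simp only [cmOfReal_apply, imEntry_apply, ContinuousMap.smul_apply, ContinuousMap.sub_apply,
        ContinuousMap.star_apply, entryCZd_apply, smul_eq_mul, Complex.im_eq_sub_conj, Complex.star_def]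
      have hI : (2 * Complex.I) ≠ 0 := mul_ne_zero two_ne_zero Complex.I_ne_zero
      field_simp
      ring_nf
      rw [Complex.I_sq]
      ring
    rw [SetLike.mem_coe, Subalgebra.mem_comap, Subalgebra.mem_restrictScalars, e1]
    exact Subalgebra.smul_mem _ (Subalgebra.sub_mem _ (hE e a b) (hS e a b)) _

variable [CompactSpace G] [MeasurableSpace G] [BorelSpace G] [SecondCountableTopology G]
variable {r}

/-- ★★★ **FIRST FUNDAMENTAL THEOREM on `ℤ^d`**: for a compact gauge group with `SU(N) ⊆ ρ(G) ⊆ U(N)`,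
`N ≥ 1`, every gauge-invariant polynomial local observable on `ℤ^d` is a polynomial in the Wilson
loops through the origin. -/
theorem mem_loopAlgebraZd_of_isZdGaugeInvariant (hSU : ContainsSU r) (hN : 0 < r.N)
    {f : C(LGConfig d G, ℝ)} (hf : f ∈ polyAlgebra (ι := ZdEdge d) r) (hfi : IsZdGaugeInvariant (⇑f)) :
    f ∈ loopAlgebraZd (d := d) r 0 := by
  have hFi : IsZdGaugeInvariant (⇑(cmOfReal f)) := fun γ U => by simp only [cmOfReal_apply, hfi γ U]
  have hmem := mem_loopAlgebraCZd_of_isZdGaugeInvariant hSU hN (cmOfReal_mem_polyAlgebraCZd r hf) hFi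
  have h := (cmRe_mem_of_mem_adjoin (A := loopAlgebraZd (d := d) r 0) (fun F hF => by
    obtain ⟨w, hw, rfl⟩ := hF
    exact ⟨Algebra.subset_adjoin ⟨w, hw, Or.inl rfl⟩, Algebra.subset_adjoin ⟨w, hw, Or.inr rfl⟩⟩) hmem).1
  rwa [cmRe_cmOfReal] at h

/-- ★★★ **FFT on `ℤ^d`, iff form.** -/
theorem isZdGaugeInvariant_iff_mem_loopAlgebraZd (hSU : ContainsSU r) (hN : 0 < r.N)
    {f : C(LGConfig d G, ℝ)} (hf : f ∈ polyAlgebra (ι := ZdEdge d) r) :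
    IsZdGaugeInvariant (⇑f) ↔ f ∈ loopAlgebraZd (d := d) r 0 :=
  ⟨mem_loopAlgebraZd_of_isZdGaugeInvariant hSU hN hf, fun h => (loopAlgebraZd_le r 0 h).2⟩

/-- ★★ **The `ℤ^d` gauge average of every polynomial local observable is a Wilson-loop polynomial.** -/
theorem gaugeAvgZdL_mem_loopAlgebraZd (hSU : ContainsSU r) (hN : 0 < r.N)
    {f : C(LGConfig d G, ℝ)} (hf : f ∈ polyAlgebra (ι := ZdEdge d) r) :
    gaugeAvgZdL d G f ∈ loopAlgebraZd (d := d) r 0 :=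
  mem_loopAlgebraZd_of_isZdGaugeInvariant hSU hN (gaugeAvgZdL_mem_polyAlgebra r hf)
    (isZdGaugeInvariant_gaugeAvgZdL f)

/-- ★★★ `SU(N)` on `ℤ^d`: gauge-invariant polynomial local observables = the Wilson loop algebra. -/
theorem isZdGaugeInvariant_iff_mem_loopAlgebraZd_suN (N : ℕ) (hN : 0 < N)
    {f : C(LGConfig d (Matrix.specialUnitaryGroup (Fin N) ℂ), ℝ)}
    (hf : f ∈ polyAlgebra (ι := ZdEdge d) (fundamentalLatticeRep N)) :
    IsZdGaugeInvariant (⇑f) ↔ f ∈ loopAlgebraZd (d := d) (fundamentalLatticeRep N) 0 :=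
  isZdGaugeInvariant_iff_mem_loopAlgebraZd (containsSU_suN N) hN hf

/-- ★★★ `U(N)` on `ℤ^d`: gauge-invariant polynomial local observables = the Wilson loop algebra. -/
theorem isZdGaugeInvariant_iff_mem_loopAlgebraZd_uN (N : ℕ) (hN : 0 < N)
    {f : C(LGConfig d (Matrix.unitaryGroup (Fin N) ℂ), ℝ)}
    (hf : f ∈ polyAlgebra (ι := ZdEdge d) (unitaryFundamentalLatticeRep N)) :
    IsZdGaugeInvariant (⇑f) ↔ f ∈ loopAlgebraZd (d := d) (unitaryFundamentalLatticeRep N) 0 :=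
  isZdGaugeInvariant_iff_mem_loopAlgebraZd (containsSU_uN N) hN hf

end Zd

end Summit.QuantumFields.GaugeBoot

end
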